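import Mathlib
import HarnessLib
import Literature.MathematicalPhysics.QuantumFieldTheory.WilsonPlaquetteWeakCouplingFloor
import Summits.Ventures.LatticeQCDFlow.Scaling.AutoregressiveProposalAcceptance
import Summits.Ventures.LatticeQCDFlow.Scaling.AutoregressiveGaugeVertexBlindProposal
import Summits.Ventures.LatticeQCDFlow.Scaling.AutoregressiveGaugePlaquetteMarginal

/-!
# LatticeQCDFlow / Scaling — A VOLUME-UNIFORM ACCEPTANCE CEILING: an exact sampler whose proposal generates
# some gauge link after its staple, from a conditional that ignores the links at one endpoint of that link,
# accepts in equilibrium at most `1 − ⟨(1/N) Re tr U_p⟩_β / 4` — every compact gauge group with a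
# non-trivial central scalar, every dimension, every volume

HONEST FRAMING: exact (Metropolis-corrected) sampling algorithms for lattice gauge theory;
figures of merit are autocorrelation/cost numbers at stated couplings and volumes; no
continuum-physics claim.

Venture `LatticeQCDFlow` (cell pub-lqcd), topic `Scaling`, FANOUT row 30 (lean-1, GEN-19) — OUR WORK on
THEORY-2.md §4 row C5, the NUMBER at the end of the chain: `Scaling/AutoregressiveProposalAcceptance`
(`ā ≤ 1 − (1/(4Z))∫|A_s F − q·A_{insert a s} F| dπ` for every proposal law with conditional `q` at `a`),
`Scaling/AutoregressiveGaugeVertexBlindProposal` (a conditional blind at one endpoint of `a` is no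
better than the flat Haar law), `Scaling/AutoregressiveGaugePlaquetteMarginal` (the flat law is, given one
staple, at Wilson-average `L¹` distance `≥ (1/N)∫Re tr ρ(U_p) e^{−βS_W}` from the exact conditional) and
the tree's weak-coupling plaquette floor `Literature/…/WilsonPlaquetteWeakCouplingFloor`.

## What is proved

* §1 (general product of probability spaces, bounded measurable functions)
  `coordAvg_union_of_bounded` — the block tower `A_{s ∪ t} = A_t ∘ A_s` (`s`, `t` disjoint);
  **`integral_abs_condGap_mono`** — LESS CONTEXT, CLOSER TO FLAT: for `s ⊆ s₂ ∌ a`,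
  `∫|A_{s₂}F − A_{insert a s₂}F| dπ ≤ ∫|A_s F − A_{insert a s}F| dπ` (the mean `L¹` distance between the
  exact conditional of `a` and the flat law can only shrink when more coordinates are integrated out).
* §2 (Wilson weight `F = e^{−βS_W}`, `π = Haar^{⊗E}` on `(ℤ/L)^d`, `L ≥ 2`, continuous `ρ` into `N × N`
  matrices with a central element acting by a scalar `ω ≠ 1`; a plaquette `p = (x; k, l)` with closing
  link `a = (x, k)`; `s` ANY set of links contained in the links off the plaquette — i.e. when `a` is
  generated its context CONTAINS the staple `(x+e_k, l), (x+e_l, k), (x, l)`; a bounded measurable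
  proposal density `Q` with `∫Q dπ = 1` whose conditional at `a` given the context is `q`
  (`A_s Q = q·A_{insert a s} Q`, `q ≥ 0` bounded measurable, normalised in `a`) and `q` BLIND TO EVERY
  OTHER LINK AT ONE ENDPOINT `y` OF `a`):
  **`wilson_meanAccept_le_of_vertexBlind`** —
  `ā = ∫∫ min((F(U)/Z)Q(V), (F(V)/Z)Q(U)) dπ dπ ≤ 1 − (1/(4NZ)) ∫ Re tr ρ(U_p)·F dπ = 1 − ¼⟨(1/N)Re tr U_p⟩_β`;
  **`wilson_meanAccept_le_linkBall`** (unitary `ρ`, `N ≥ 1`, `d ≥ 2`, `β > 0`, every `r > 0`) —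
  `ā ≤ 1 − ¼(1 − 8r²/N + 2 log φ_ρ(r)/((d−1)Nβ))`, `φ_ρ(r)` the Haar mass of `{‖ρ(g) − 1‖ ≤ r}`:
  UNIFORM IN THE VOLUME, tending to `3/4` as `β → ∞`.

READING (value-free): in EVERY generation order the LAST link is generated after all its staples, so an
exact (Metropolis-corrected) sampler built on an autoregressive proposal whose final conditional ignores
the links at one endpoint of the final link rejects at least a quarter of the mean plaquette
`⟨(1/N)Re tr U_p⟩_β` of its proposals, at every volume — for `SU(N)`, `U(N)`, `U(1)` in every dimension.
NOT CLAIMED: conditioners that read both endpoints (the interesting ones); the sharp constant; any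
statement about autocorrelation beyond the acceptance; representations without a non-trivial central
scalar.  Elementary over the parents; no `def`; nothing is cited as a fact beyond the tree; no `sorry`.
-/

noncomputable section

namespace Summit.Ventures.LatticeQCDFlow.Theory2.Autoregressive

open MeasureTheory Function Set
open Literature.MathematicalPhysics.QuantumFieldTheory Literature.MathematicalPhysics.QuantumLattice
open Summit.Ventures.LatticeQCDFlow.Exactness
open scoped Matrix Matrix.Norms.Frobenius

/-! ## §1 Less context, closer to flat -/

section General

variable {ι : Type*} [Fintype ι] [DecidableEq ι] {X : Type*} [MeasurableSpace X]
variable (μ : Measure X) [IsProbabilityMeasure μ]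

/-- **The block tower `A_{s ∪ t} = A_t ∘ A_s`** for disjoint `s`, `t` and bounded measurable `h`. [ours] -/
theorem coordAvg_union_of_bounded (s t : Finset ι) (hst : Disjoint s t) {h : (ι → X) → ℝ}
    (hm : Measurable h) {C : ℝ} (hb : ∀ ω, |h ω| ≤ C) :
    coordAvg μ (s ∪ t) h = coordAvg μ t (coordAvg μ s h) := by
  induction s using Finset.induction_on generalizing h with
  | empty => rw [Finset.empty_union, coordAvg_empty]
  | @insert k s₀ hk ih =>
    have hkt : k ∉ t := fun hkt' => (Finset.disjoint_insert_left.1 hst).1 hkt'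
    have hst₀ : Disjoint s₀ t := (Finset.disjoint_insert_left.1 hst).2
    have hk' : k ∉ s₀ ∪ t := by
      rw [Finset.mem_union, not_or]; exact ⟨hk, hkt⟩
    have hkm : Measurable (coordAvg μ {k} h) := measurable_coordAvg μ {k} hm
    have hkb : ∀ ω, |coordAvg μ {k} h ω| ≤ C := abs_coordAvg_le_of_abs_le μ {k} hm hb
    funext ω
    rw [Finset.insert_union, coordAvg_insert_of_bounded μ hk' hm hb ω, ih hst₀ hkm hkb]
    congr 1
    funext η
    rw [coordAvg_insert_of_bounded μ hk hm hb η]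

/-- **LESS CONTEXT, CLOSER TO FLAT**: for `s ⊆ s₂` with `a ∉ s₂` and bounded measurable `F`,
`∫ |A_{s₂} F − A_{insert a s₂} F| dπ ≤ ∫ |A_s F − A_{insert a s} F| dπ` — integrating out more coordinates
can only shrink the mean `L¹` distance between the exact conditional of `a` and the flat law. [ours] -/
theorem integral_abs_condGap_mono {a : ι} {s s₂ : Finset ι} (hss : s ⊆ s₂) (ha : a ∉ s₂)
    {F : (ι → X) → ℝ} (hFm : Measurable F) {C : ℝ} (hFb : ∀ ω, |F ω| ≤ C) :
    ∫ ω, |coordAvg μ s₂ F ω - coordAvg μ (insert a s₂) F ω| ∂Measure.pi (fun _ : ι => μ) ≤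
      ∫ ω, |coordAvg μ s F ω - coordAvg μ (insert a s) F ω| ∂Measure.pi (fun _ : ι => μ) := by
  set t : Finset ι := s₂ \ s with ht
  have hst : Disjoint s t := Finset.disjoint_sdiff
  have hs₂ : s ∪ t = s₂ := Finset.union_sdiff_of_subset hss
  have has : a ∉ s := fun h => ha (hss h)
  have hat : a ∉ t := fun h => ha (Finset.sdiff_subset h)
  have hst' : Disjoint (insert a s) t := Finset.disjoint_insert_left.2 ⟨hat, hst⟩
  have hs₂' : insert a s ∪ t = insert a s₂ := by rw [Finset.insert_union, hs₂]
  -- the gap `D = A_s F − A_{insert a s} F`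
  have hNm : Measurable (coordAvg μ s F) := measurable_coordAvg μ s hFm
  have hMm : Measurable (coordAvg μ (insert a s) F) := measurable_coordAvg μ (insert a s) hFm
  have hNb : ∀ ω, |coordAvg μ s F ω| ≤ C := abs_coordAvg_le_of_abs_le μ s hFm hFb
  have hMb : ∀ ω, |coordAvg μ (insert a s) F ω| ≤ C := abs_coordAvg_le_of_abs_le μ (insert a s) hFm hFb
  have hDm : Measurable fun ω => coordAvg μ s F ω - coordAvg μ (insert a s) F ω := hNm.sub hMm
  have hDb : ∀ ω, |coordAvg μ s F ω - coordAvg μ (insert a s) F ω| ≤ C + C := fun ω =>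
    (abs_sub _ _).trans (add_le_add (hNb ω) (hMb ω))
  -- `A_{s₂} F − A_{insert a s₂} F = A_t D`
  have hgap : ∀ ω, coordAvg μ s₂ F ω - coordAvg μ (insert a s₂) F ω =
      coordAvg μ t (fun η => coordAvg μ s F η - coordAvg μ (insert a s) F η) ω := by
    intro ω
    rw [coordAvg_sub_of_abs_le μ t hNm hNb hMm hMb ω, ← coordAvg_union_of_bounded μ s t hst hFm hFb,
      ← coordAvg_union_of_bounded μ (insert a s) t hst' hFm hFb, hs₂', hs₂]
  calc ∫ ω, |coordAvg μ s₂ F ω - coordAvg μ (insert a s₂) F ω| ∂Measure.pi (fun _ : ι => μ)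
      = ∫ ω, |coordAvg μ t (fun η => coordAvg μ s F η - coordAvg μ (insert a s) F η) ω|
          ∂Measure.pi (fun _ : ι => μ) := by
        simp only [hgap]
    _ ≤ ∫ ω, |coordAvg μ s F ω - coordAvg μ (insert a s) F ω| ∂Measure.pi (fun _ : ι => μ) :=
        pi_integral_abs_coordAvg_le μ t hDm hDb

end General

/-! ## §2 The volume-uniform acceptance ceiling for Wilson lattice gauge theory -/

section Wilson

variable {d L N : ℕ} {G : Type*} [Group G] [TopologicalSpace G] [IsTopologicalGroup G]
  [CompactSpace G] [SecondCountableTopology G] [MeasurableSpace G] [BorelSpace G] [NeZero L]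
  (ρ : G →* Matrix (Fin N) (Fin N) ℂ)

/-- **THE ACCEPTANCE CEILING `1 − ¼⟨(1/N) Re tr U_p⟩_β`.**  Continuous `ρ` with a central element acting by
a scalar `ω ≠ 1`, `L ≥ 2`, any `β`; plaquette `p = (x; k, l)`, closing link `a = (x, k)`; `s` any set of
links off the plaquette (the links generated after `a`; so the context of `a` contains the staple); a
bounded measurable proposal density `Q` (`∫ Q dπ = 1`) whose conditional at `a` is `q` (`A_s Q =
q·A_{insert a s} Q`, `q ≥ 0` bounded measurable, normalised in `a`), `q` blind to every other link at the
endpoint `y` of `a`.  Then the equilibrium acceptance of the exact independence-Metropolis sampler with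
target `e^{−βS_W}/Z` and proposal `Q` is at most `1 − (1/(4NZ)) ∫ Re tr ρ(U_p) e^{−βS_W} dπ`. [ours] -/
theorem wilson_meanAccept_le_of_vertexBlind (hρ : Continuous ρ) (hL : 2 ≤ L)
    {z : G} {ω : ℂ} (hω : ρ z = ω • (1 : Matrix (Fin N) (Fin N) ℂ)) (hne : ω ≠ 1) (β : ℝ)
    (p : Plaquette d L) {s : Finset (Edge d L)}
    (hs : s ⊆ Finset.univ \
      {(p.1, p.2.1.1), (p.1.shift p.2.1.1, p.2.1.2), (p.1.shift p.2.1.2, p.2.1.1), (p.1, p.2.1.2)})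
    {Q q : GaugeConfig d L G → ℝ} (hQm : Measurable Q) (hQ0 : ∀ U, 0 ≤ Q U) {CQ : ℝ}
    (hQb : ∀ U, Q U ≤ CQ) (hQ1 : ∫ U, Q U ∂Measure.pi (fun _ : Edge d L => haarProbability G) = 1)
    (hqm : Measurable q) (hq0 : ∀ U, 0 ≤ q U) {Cq : ℝ} (hqb : ∀ U, q U ≤ Cq)
    (hq1 : ∀ U, ∫ v, q (update U (p.1, p.2.1.1) v) ∂(haarProbability G) = 1)
    (hfac : ∀ U, coordAvg (haarProbability G) s Q U =
      q U * coordAvg (haarProbability G) (insert (p.1, p.2.1.1) s) Q U)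
    {y : Site d L} (hy : p.1 = y ∨ p.1.shift p.2.1.1 = y)
    (hqB : ∀ e : Edge d L, e.1 = y ∨ e.1.shift e.2 = y → e ≠ (p.1, p.2.1.1) →
      ∀ (U : GaugeConfig d L G) (v : G), q (update U e v) = q U) :
    ∫ U, ∫ V, min
        (Real.exp (-β * wilsonAction ρ U) /
            (∫ W, Real.exp (-β * wilsonAction ρ W) ∂Measure.pi (fun _ : Edge d L => haarProbability G)) *
          Q V)
        (Real.exp (-β * wilsonAction ρ V) /
            (∫ W, Real.exp (-β * wilsonAction ρ W) ∂Measure.pi (fun _ : Edge d L => haarProbability G)) *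
          Q U)
        ∂Measure.pi (fun _ : Edge d L => haarProbability G)
        ∂Measure.pi (fun _ : Edge d L => haarProbability G) ≤
      1 - 1 / (4 * N * ∫ W, Real.exp (-β * wilsonAction ρ W)
              ∂Measure.pi (fun _ : Edge d L => haarProbability G)) *
        ∫ U, (ρ (plaquetteHolonomy U p.1 p.2.1.1 p.2.1.2)).trace.re * Real.exp (-β * wilsonAction ρ U)
          ∂Measure.pi (fun _ : Edge d L => haarProbability G) := by
  classical
  set μ := haarProbability G with hμ
  set π := Measure.pi (fun _ : Edge d L => μ) with hπ
  set F : GaugeConfig d L G → ℝ := fun U => Real.exp (-β * wilsonAction ρ U) with hF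
  set a : Edge d L := (p.1, p.2.1.1) with ha
  set sH : Finset (Edge d L) := Finset.univ \
      {(p.1, p.2.1.1), (p.1.shift p.2.1.1, p.2.1.2), (p.1.shift p.2.1.2, p.2.1.1), (p.1, p.2.1.2)} with hsH
  set Z : ℝ := ∫ W, F W ∂π with hZ
  set I : ℝ := ∫ U, |coordAvg μ s F U - q U * coordAvg μ (insert a s) F U| ∂π with hI
  set X : ℝ := ∫ U, (ρ (plaquetteHolonomy U p.1 p.2.1.1 p.2.1.2)).trace.re * F U ∂π with hX
  -- the weight
  obtain ⟨hFm, B, hFlo, hFhi⟩ := wilsonWeight_props (d := d) (L := L) ρ hρ β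
  have hF0 : ∀ U : GaugeConfig d L G, 0 ≤ F U := fun U => (Real.exp_pos _).le
  have hFabs : ∀ U : GaugeConfig d L G, |F U| ≤ Real.exp (|β| * B) := fun U => by
    rw [abs_of_pos (Real.exp_pos _)]; exact hFhi U
  have hZpos : 0 < Z :=
    integral_exp_pos (Literature.Probability.LatticeModels.integrable_of_continuous_compactSpace _
      (Real.continuous_exp.comp (continuous_const.mul (continuous_wilsonAction ρ hρ))))
  -- (1) the acceptance form
  have hacc := meanAccept_le_of_condProposal μ s hFm hF0 hFhi hZpos hQm hQ0 hQb hQ1 hqm hq0 hqb hq1 hfac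
  -- (2) the vertex-blind conditional is no better than Haar
  haveI : Fact (1 < L) := ⟨hL⟩
  have hloop : a.1 ≠ a.1.shift a.2 := fun h => (site_shift_ne hL p.1 p.2.1.1) (by rw [ha] at h; exact h.symm)
  have hy' : a.1 = y ∨ a.1.shift a.2 = y := by simpa [ha] using hy
  have hqabs : ∀ U, |q U| ≤ Cq := fun U => by rw [abs_of_nonneg (hq0 U)]; exact hqb U
  have hV := integral_abs_sub_le_of_vertexBlind s (insert a s) (isGaugeInvariant_wilsonWeightFun ρ β)
    hFm ⟨_, hFabs⟩ hy' hloop hqm ⟨Cq, hqabs⟩ (by simpa [ha] using hqB) (by simpa [ha] using hq1)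
  -- (3) less context, closer to flat: from `s` to the links off the plaquette
  have hasH : a ∉ sH := by simp [hsH, ha]
  have hmono := integral_abs_condGap_mono μ hs hasH hFm hFabs
  -- (4) the engine: the flat law is far from the one-staple conditional
  have hH := wilson_plaquetteMarginal_tv_lower_bound (d := d) (L := L) ρ hρ hL hω hne β p
  -- assemble
  have hXle : X ≤ (N : ℝ) * I := hH.trans (mul_le_mul_of_nonneg_left (hmono.trans hV) (Nat.cast_nonneg N))
  have hI0 : 0 ≤ I := integral_nonneg fun U => abs_nonneg _
  rcases Nat.eq_zero_or_pos N with hN0 | hNpos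
  · subst hN0
    have : (1 : ℝ) / (4 * ((0 : ℕ) : ℝ) * Z) * X = 0 := by simp
    rw [this, sub_zero]
    have h2 : 0 ≤ 1 / (4 * Z) * I := mul_nonneg (by positivity) hI0
    linarith
  · have hNr : (0 : ℝ) < N := by exact_mod_cast hNpos
    have hkey : 1 / (4 * N * Z) * X ≤ 1 / (4 * Z) * I := by
      calc 1 / (4 * N * Z) * X ≤ 1 / (4 * N * Z) * ((N : ℝ) * I) :=
            mul_le_mul_of_nonneg_left hXle (by positivity)
        _ = 1 / (4 * Z) * I := by field_simp
    linarith

/-- **THE VOLUME-UNIFORM NUMBER**: under the hypotheses of `wilson_meanAccept_le_of_vertexBlind` with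
`ρ` unitary, `N ≥ 1`, `d ≥ 2`, `β > 0`, for every `r > 0`:
`ā ≤ 1 − ¼·(1 − 8r²/N + 2 log φ_ρ(r)/((d−1)Nβ))`, `φ_ρ(r) = Haar{‖ρ(g) − 1‖ ≤ r}` — independent of the
volume `L`, and `→ 3/4` as `β → ∞` (choose `r → 0` slowly). [ours] -/
theorem wilson_meanAccept_le_linkBall (hd : 2 ≤ d) (hN : 1 ≤ N) (hρ : Continuous ρ)
    (hρU : ∀ g, ρ g ∈ Matrix.unitaryGroup (Fin N) ℂ) (hL : 2 ≤ L)
    {z : G} {ω : ℂ} (hω : ρ z = ω • (1 : Matrix (Fin N) (Fin N) ℂ)) (hne : ω ≠ 1)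
    {β : ℝ} (hβ : 0 < β) {r : ℝ} (hr : 0 < r)
    (p : Plaquette d L) {s : Finset (Edge d L)}
    (hs : s ⊆ Finset.univ \
      {(p.1, p.2.1.1), (p.1.shift p.2.1.1, p.2.1.2), (p.1.shift p.2.1.2, p.2.1.1), (p.1, p.2.1.2)})
    {Q q : GaugeConfig d L G → ℝ} (hQm : Measurable Q) (hQ0 : ∀ U, 0 ≤ Q U) {CQ : ℝ}
    (hQb : ∀ U, Q U ≤ CQ) (hQ1 : ∫ U, Q U ∂Measure.pi (fun _ : Edge d L => haarProbability G) = 1)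
    (hqm : Measurable q) (hq0 : ∀ U, 0 ≤ q U) {Cq : ℝ} (hqb : ∀ U, q U ≤ Cq)
    (hq1 : ∀ U, ∫ v, q (update U (p.1, p.2.1.1) v) ∂(haarProbability G) = 1)
    (hfac : ∀ U, coordAvg (haarProbability G) s Q U =
      q U * coordAvg (haarProbability G) (insert (p.1, p.2.1.1) s) Q U)
    {y : Site d L} (hy : p.1 = y ∨ p.1.shift p.2.1.1 = y)
    (hqB : ∀ e : Edge d L, e.1 = y ∨ e.1.shift e.2 = y → e ≠ (p.1, p.2.1.1) →
      ∀ (U : GaugeConfig d L G) (v : G), q (update U e v) = q U) :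
    ∫ U, ∫ V, min
        (Real.exp (-β * wilsonAction ρ U) /
            (∫ W, Real.exp (-β * wilsonAction ρ W) ∂Measure.pi (fun _ : Edge d L => haarProbability G)) *
          Q V)
        (Real.exp (-β * wilsonAction ρ V) /
            (∫ W, Real.exp (-β * wilsonAction ρ W) ∂Measure.pi (fun _ : Edge d L => haarProbability G)) *
          Q U)
        ∂Measure.pi (fun _ : Edge d L => haarProbability G)
        ∂Measure.pi (fun _ : Edge d L => haarProbability G) ≤
      1 - (1 / 4) * (1 - 8 * r ^ 2 / N +
        2 * Real.log ((haarProbability G).real {g : G | ‖ρ g - 1‖ ≤ r}) / (((d : ℝ) - 1) * N * β)) := by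
  set π := Measure.pi (fun _ : Edge d L => haarProbability G) with hπ
  set Z : ℝ := ∫ W, Real.exp (-β * wilsonAction ρ W) ∂π with hZ
  set X : ℝ := ∫ U, (ρ (plaquetteHolonomy U p.1 p.2.1.1 p.2.1.2)).trace.re *
    Real.exp (-β * wilsonAction ρ U) ∂π with hX
  have hZpos : 0 < Z :=
    integral_exp_pos (Literature.Probability.LatticeModels.integrable_of_continuous_compactSpace _
      (Real.continuous_exp.comp (continuous_const.mul (continuous_wilsonAction ρ hρ))))
  have hNr : (0 : ℝ) < N := by exact_mod_cast hN
  -- the ceiling in terms of the plaquette mean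
  have hceil := wilson_meanAccept_le_of_vertexBlind (d := d) (L := L) ρ hρ hL hω hne β p hs hQm hQ0 hQb
    hQ1 hqm hq0 hqb hq1 hfac hy hqB
  -- the tree's weak-coupling floor on `⟨(1/N) Re tr U_p⟩ = N⁻¹ X / Z`
  have hfloor := wilsonExpectation_plaquette_ge_linkBall (d := d) (L := L) ρ hd hN hρ hρU hβ hr p.1
    (ne_of_lt p.2.2)
  rw [wilsonExpectation_eq_integral_div ρ hρ] at hfloor
  have hnum : ∫ U, (N : ℝ)⁻¹ * (ρ (plaquetteHolonomy U p.1 p.2.1.1 p.2.1.2)).trace.re *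
        Real.exp (-β * wilsonAction ρ U) ∂π = (N : ℝ)⁻¹ * X := by
    rw [hX, ← integral_const_mul]
    refine integral_congr_ae (ae_of_all _ fun U => ?_)
    ring
  rw [hnum] at hfloor
  -- `floor ≤ N⁻¹ X / Z = (1/(N Z)) X`, so `¼ floor ≤ (1/(4 N Z)) X`
  have hkey : (1 / 4 : ℝ) * (1 - 8 * r ^ 2 / N +
        2 * Real.log ((haarProbability G).real {g : G | ‖ρ g - 1‖ ≤ r}) / (((d : ℝ) - 1) * N * β)) ≤
      1 / (4 * N * Z) * X := by
    have e : 1 / (4 * N * Z) * X = (1 / 4) * ((N : ℝ)⁻¹ * X / Z) := by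
      field_simp
    rw [e]
    exact mul_le_mul_of_nonneg_left hfloor (by norm_num)
  linarith

end Wilson

end Summit.Ventures.LatticeQCDFlow.Theory2.Autoregressive

end
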